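import Mathlib
import HarnessLib
import Literature.AlgebraicGeometry.DeterminantalHypersurfaces.HeltonVinnikov
import Summits.ValiantsHypothesis.ValiantsHypothesis.Theorems.PermanentalConesHyperbolicVPShadowStubHighEffNetzerSanyal
import Summits.ValiantsHypothesis.ValiantsHypothesis.Theorems.PermanentalConesHyperbolicVPShadowStubFramePencilHyperbolicForm
import Summits.ValiantsHypothesis.ValiantsHypothesis.Theorems.PermanentalConesHyperbolicVPShadowStubRealifyHermitianPencil
import Summits.ValiantsHypothesis.ValiantsHypothesis.Theorems.PermanentalConesHyperbolicVPShadowStubSpectrahedronOfSymmDetPower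
import Summits.ValiantsHypothesis.ValiantsHypothesis.Theorems.PermanentalConesHyperbolicVPShadowStubHermitianPencilOfHanselkaKummer
import Summits.ValiantsHypothesis.ValiantsHypothesis.Theorems.PermanentalConesHyperbolicVPShadowStubHkLayerGlue
import Summits.ValiantsHypothesis.ValiantsHypothesis.Theorems.PermanentalConesHyperbolicVPShadowStubDimLeFourOfOshime

/-!
# ValiantsHypothesis / PermanentalCones — `HyperbolicVPShadow`: the open core `H₄` is still
Netzer–Sanyal-hard (honesty certificate of the lead's c4 reshape)

Route `PermanentalCones`, item `stmt-ValiantsHypothesis-8655` (crux `HyperbolicVPShadow`), line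
`birth`. Lead c4 carved the `N = 3` case out of the open high-layer stub `H` of the skeleton: by
Hanselka–Kummer 2023 Cor. 12.10 (hyperbolic cubics in four variables are hermitian determinantal)
and Oshime's 1991 dimension theorems (real-spectrum 3×3 families with `≥ 4` generators are
symmetrisable or have a common right/left eigenvector) — all three taken VERBATIM as hypotheses
here, exactly as in the skeleton's fact stubs — together with the landed stubs Tₖ, R, S⁺, HKₑ, G_HK
and D₄, every irreducible, not simultaneously symmetrisable real-spectrum 3×3 pencil spanning
`≥ 4` dimensions has a size-`6` spectrahedral cone (`permanentalCones_hkLayer_N3`). Consequently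
the remaining open stub `H₄` (`N ≥ 4`) still implies, together with the Lax conjecture (named fact)
and these three published theorems, the Netzer–Sanyal conjecture "every hyperbolicity cone is a
spectrahedral shadow" (`permanentalCones_netzerSanyal_of_highEff_ge4`, through the landed
`stub_highEff_netzerSanyal`, p159239): the c4 reshape has not trivialised the registered open stub.
All bookkeeping; no new mathematics. [folklore]
-/

set_option linter.dupNamespace false

noncomputable section

namespace Summit.ValiantsHypothesis.ValiantsHypothesis.Theorems

open Matrix

/-- **The Hanselka–Kummer layer** (`N = 3` of the high layer, size `6`), from the three published
statements taken verbatim as hypotheses — Hanselka–Kummer 2023 Cor. 12.10 (normal form at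
`e = (1,0,0,0)`), Oshime (I) 1991 Thm 5.1, Oshime (II) 1991 Thm 6.1 + Lemma 3.2 — and the landed
stubs D₄ (dimension `≤ 4`), HKₑ (general direction), Tₖ (frame pencils are hyperbolic forms), R
(realification), S⁺ (symmetric determinantal powers), G_HK (glue): every linear pencil of real
3×3 matrices with only real eigenvalues that is irreducible and not simultaneously symmetrisable
has a closed nonnegative-spectrum cone that is a spectrahedron of size `6`. [folklore] -/
theorem permanentalCones_hkLayer_N3
    (hHK : ∀ (p : MvPolynomial (Fin 4) ℝ), p.IsHomogeneous 3 →
      MvPolynomial.eval ![1, 0, 0, 0] p = 1 →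
      (∀ w : Fin 4 → ℝ, Multiset.card (MvPolynomial.aeval
          (fun i => Polynomial.C (w i) - Polynomial.C ((![1, 0, 0, 0] : Fin 4 → ℝ) i) * Polynomial.X)
          p).roots = 3) →
      ∃ A₁ A₂ A₃ : Matrix (Fin 3) (Fin 3) ℂ, A₁.IsHermitian ∧ A₂.IsHermitian ∧ A₃.IsHermitian ∧
        ∀ x : Fin 4 → ℝ, ((MvPolynomial.eval x p : ℝ) : ℂ) =
          ((x 0 : ℂ) • (1 : Matrix (Fin 3) (Fin 3) ℂ) + (x 1 : ℂ) • A₁ + (x 2 : ℂ) • A₂ +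
            (x 3 : ℂ) • A₃).det)
    (hOa : ∀ (n : ℕ) (A : Fin n → Matrix (Fin 3) (Fin 3) ℝ), 4 ≤ n →
      LinearIndependent ℝ (Fin.cons (1 : Matrix (Fin 3) (Fin 3) ℝ) A) →
      (∀ ξ : Fin n → ℝ, ∃ S : Matrix (Fin 3) (Fin 3) ℝ, IsUnit S ∧
        ∃ D : Fin 3 → ℝ, S⁻¹ * (∑ i, ξ i • A i) * S = Matrix.diagonal D) →
      ∃ T : Matrix (Fin 3) (Fin 3) ℝ, IsUnit T ∧ ∀ i, (T⁻¹ * A i * T).IsSymm)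
    (hOb : ∀ (n : ℕ) (A : Fin n → Matrix (Fin 3) (Fin 3) ℝ), 4 ≤ n →
      LinearIndependent ℝ (Fin.cons (1 : Matrix (Fin 3) (Fin 3) ℝ) A) →
      (∀ (ξ : Fin n → ℝ) (z : ℂ),
        ((∑ i, ξ i • A i).map (algebraMap ℝ ℂ) - z • (1 : Matrix (Fin 3) (Fin 3) ℂ)).det = 0 →
          z.im = 0) →
      (¬ ∀ ξ : Fin n → ℝ, ∃ S : Matrix (Fin 3) (Fin 3) ℝ, IsUnit S ∧
        ∃ D : Fin 3 → ℝ, S⁻¹ * (∑ i, ξ i • A i) * S = Matrix.diagonal D) →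
      (∃ v : Fin 3 → ℝ, v ≠ 0 ∧ ∀ i, ∃ μ : ℝ, (A i).mulVec v = μ • v) ∨
      (∃ w : Fin 3 → ℝ, w ≠ 0 ∧ ∀ i, ∃ μ : ℝ, Matrix.vecMul w (A i) = μ • w))
    (n : ℕ) (P : (Fin n → ℝ) →ₗ[ℝ] Matrix (Fin 3) (Fin 3) ℝ)
    (hP : ∀ (x : Fin n → ℝ) (z : ℂ),
      ((P x).map (algebraMap ℝ ℂ) - z • (1 : Matrix (Fin 3) (Fin 3) ℂ)).det = 0 → z.im = 0)
    (hirr : ∀ W : Submodule ℝ (Fin 3 → ℝ), (∀ (x : Fin n → ℝ), ∀ v ∈ W, Matrix.mulVec (P x) v ∈ W) →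
      W = ⊥ ∨ W = ⊤)
    (hns : ¬ ∃ S : Matrix (Fin 3) (Fin 3) ℝ, S.PosDef ∧ ∀ x : Fin n → ℝ, (S * P x).IsSymm) :
    Literature.AlgebraicGeometry.HyperbolicPolynomials.IsSpectrahedralShadowOfSize
      {x : Fin n → ℝ | ∀ τ : ℝ, 0 < τ → (P x + τ • (1 : Matrix (Fin 3) (Fin 3) ℝ)).det ≠ 0} 6 :=
  stub_hkLayer_glue (fun b e => stub_framePencil_hyperbolicForm 3 4 b e)
    (stub_hermitianPencil_of_hanselkaKummer hHK) stub_realify_hermitianPencil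
    stub_spectrahedron_of_symmDetPower n P hP
    (stub_dimLeFour_of_oshime hOa hOb n P hP hirr hns)

/-- **The open core `H₄` is still Netzer–Sanyal-hard** (honesty certificate of the lead's c4
reshape of crux `HyperbolicVPShadow`): the registered open stub `H₄` (irreducible, not
simultaneously symmetrisable real-spectrum pencils of size `N ≥ 4` spanning `≥ 4` dimensions have
closed nonnegative-spectrum cones that are lifted-LMI sets of quasi-polynomial size), together with
the Lax conjecture (the named fact `LewisParriloRamana2005_laxConjecture`) and the three published
theorems of `permanentalCones_hkLayer_N3` (Hanselka–Kummer 2023 Cor. 12.10; Oshime 1991 (I) Thm 5.1,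
(II) Thm 6.1 + Lemma 3.2 — verbatim as hypotheses), implies the Netzer–Sanyal conjecture: every
closed hyperbolicity cone of a real homogeneous hyperbolic form is a spectrahedral shadow (OPEN;
Netzer–Sanyal 2015 p. 6). Proof: `H₄` and the Hanselka–Kummer layer give stub H for `N ≥ 3` (the
skeleton's derivation, bound `c ↦ c + 2`), and the landed `stub_highEff_netzerSanyal` (p159239)
concludes. [folklore] -/
theorem permanentalCones_netzerSanyal_of_highEff_ge4
    (hH4 : ∃ c : ℕ, ∀ (n N : ℕ) (P : (Fin n → ℝ) →ₗ[ℝ] Matrix (Fin N) (Fin N) ℝ),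
      (∀ (x : Fin n → ℝ) (z : ℂ),
        ((P x).map (algebraMap ℝ ℂ) - z • (1 : Matrix (Fin N) (Fin N) ℂ)).det = 0 → z.im = 0) →
      (∀ W : Submodule ℝ (Fin N → ℝ), (∀ (x : Fin n → ℝ), ∀ v ∈ W, Matrix.mulVec (P x) v ∈ W) →
        W = ⊥ ∨ W = ⊤) →
      (¬ ∃ S : Matrix (Fin N) (Fin N) ℝ, S.PosDef ∧ ∀ x : Fin n → ℝ, (S * P x).IsSymm) →
      3 < Module.finrank ℝ (Submodule.span ℝ
        (insert (1 : Matrix (Fin N) (Fin N) ℝ) (Set.range P))) →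
      4 ≤ N →
      ∃ m ≤ 2 ^ ((Nat.log 2 N + c) ^ c),
        Literature.AlgebraicGeometry.HyperbolicPolynomials.IsSpectrahedralShadowOfSize
          {x : Fin n → ℝ | ∀ τ : ℝ, 0 < τ → (P x + τ • (1 : Matrix (Fin N) (Fin N) ℝ)).det ≠ 0} m)
    (hLax : Literature.AlgebraicGeometry.DeterminantalHypersurfaces.LewisParriloRamana2005_laxConjecture)
    (hHK : ∀ (p : MvPolynomial (Fin 4) ℝ), p.IsHomogeneous 3 →
      MvPolynomial.eval ![1, 0, 0, 0] p = 1 →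
      (∀ w : Fin 4 → ℝ, Multiset.card (MvPolynomial.aeval
          (fun i => Polynomial.C (w i) - Polynomial.C ((![1, 0, 0, 0] : Fin 4 → ℝ) i) * Polynomial.X)
          p).roots = 3) →
      ∃ A₁ A₂ A₃ : Matrix (Fin 3) (Fin 3) ℂ, A₁.IsHermitian ∧ A₂.IsHermitian ∧ A₃.IsHermitian ∧
        ∀ x : Fin 4 → ℝ, ((MvPolynomial.eval x p : ℝ) : ℂ) =
          ((x 0 : ℂ) • (1 : Matrix (Fin 3) (Fin 3) ℂ) + (x 1 : ℂ) • A₁ + (x 2 : ℂ) • A₂ +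
            (x 3 : ℂ) • A₃).det)
    (hOa : ∀ (n : ℕ) (A : Fin n → Matrix (Fin 3) (Fin 3) ℝ), 4 ≤ n →
      LinearIndependent ℝ (Fin.cons (1 : Matrix (Fin 3) (Fin 3) ℝ) A) →
      (∀ ξ : Fin n → ℝ, ∃ S : Matrix (Fin 3) (Fin 3) ℝ, IsUnit S ∧
        ∃ D : Fin 3 → ℝ, S⁻¹ * (∑ i, ξ i • A i) * S = Matrix.diagonal D) →
      ∃ T : Matrix (Fin 3) (Fin 3) ℝ, IsUnit T ∧ ∀ i, (T⁻¹ * A i * T).IsSymm)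
    (hOb : ∀ (n : ℕ) (A : Fin n → Matrix (Fin 3) (Fin 3) ℝ), 4 ≤ n →
      LinearIndependent ℝ (Fin.cons (1 : Matrix (Fin 3) (Fin 3) ℝ) A) →
      (∀ (ξ : Fin n → ℝ) (z : ℂ),
        ((∑ i, ξ i • A i).map (algebraMap ℝ ℂ) - z • (1 : Matrix (Fin 3) (Fin 3) ℂ)).det = 0 →
          z.im = 0) →
      (¬ ∀ ξ : Fin n → ℝ, ∃ S : Matrix (Fin 3) (Fin 3) ℝ, IsUnit S ∧
        ∃ D : Fin 3 → ℝ, S⁻¹ * (∑ i, ξ i • A i) * S = Matrix.diagonal D) →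
      (∃ v : Fin 3 → ℝ, v ≠ 0 ∧ ∀ i, ∃ μ : ℝ, (A i).mulVec v = μ • v) ∨
      (∃ w : Fin 3 → ℝ, w ≠ 0 ∧ ∀ i, ∃ μ : ℝ, Matrix.vecMul w (A i) = μ • w)) :
    ∀ (k : ℕ) (f : MvPolynomial (Fin k) ℝ) (e : Fin k → ℝ) (d : ℕ), f.IsHomogeneous d →
      Literature.AlgebraicGeometry.HyperbolicPolynomials.IsHyperbolic f e →
      Literature.AlgebraicGeometry.HyperbolicPolynomials.IsSpectrahedralShadow
        (Literature.AlgebraicGeometry.HyperbolicPolynomials.hyperbolicityCone f e) := by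
  refine stub_highEff_netzerSanyal ?_ hLax
  obtain ⟨c, hc⟩ := hH4
  refine ⟨c + 2, fun n N P hP hirr hns hdim hN3 => ?_⟩
  rcases hN3.eq_or_lt with h3 | h4
  · -- N = 3: the Hanselka–Kummer layer, size 6
    subst h3
    refine ⟨6, ?_, permanentalCones_hkLayer_N3 hHK hOa hOb n P hP hirr hns⟩
    have hb : 2 ≤ Nat.log 2 3 + (c + 2) := by omega
    have h1 : 3 ≤ (Nat.log 2 3 + (c + 2)) ^ (c + 2) :=
      calc 3 ≤ 2 ^ 2 := by norm_num
        _ ≤ (Nat.log 2 3 + (c + 2)) ^ 2 := Nat.pow_le_pow_left hb 2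
        _ ≤ (Nat.log 2 3 + (c + 2)) ^ (c + 2) := Nat.pow_le_pow_right (by omega) (by omega)
    calc 6 ≤ 2 ^ 3 := by norm_num
      _ ≤ 2 ^ ((Nat.log 2 3 + (c + 2)) ^ (c + 2)) := Nat.pow_le_pow_right (by norm_num) h1
  · -- N ≥ 4: the open stub, with the bound relaxed from `c` to `c + 2`
    obtain ⟨m, hm, h⟩ := hc n N P hP hirr hns hdim h4
    refine ⟨m, hm.trans (Nat.pow_le_pow_right (by norm_num) ?_), h⟩
    calc (Nat.log 2 N + c) ^ c ≤ (Nat.log 2 N + (c + 2)) ^ c := Nat.pow_le_pow_left (by omega) c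
      _ ≤ (Nat.log 2 N + (c + 2)) ^ (c + 2) := Nat.pow_le_pow_right (by omega) (by omega)

end Summit.ValiantsHypothesis.ValiantsHypothesis.Theorems
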